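import Mathlib
import Literature.NumberTheory.LFunctions.Zhang2022.Section6ZfacSize
import HarnessLib

/-!
# Zhang (2022), §6 (6.5), part 3/4: the horizontal sides of the rectangle `[−1,0] × [−𝓛²⁰,𝓛²⁰]`

Topic `Literature/NumberTheory/LFunctions/Zhang2022` (Landau–Siegel audit tree; verdict-neutral).
Y. Zhang, *Discrete mean estimates and the Landau–Siegel zero*, arXiv:2211.02515v1 (2022)
[Zhang2022LandauSiegel] — **an unrefereed manuscript under adjudication**; nothing here asserts or
denies its Theorems 1–2 or anything about Landau–Siegel zeros, and nothing bears on the verdict on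
(8.24). Campaign DAG nodes `Z22:(6.5)` / `Z22:Lem6.1.pf` (§6 p. 32, tex L1755–L1781), typed in
`Section6Statements` as `Step6split` / `Step6last`; GAP-LEDGER rows G-d08-1 / G-d08-2.

> … moving the segment `u = −1, |v| ≤ 𝓛²⁰` to `u = 0, |v| ≤ 𝓛²⁰` … ("by a trivial bound for `ω₁(w)`
> and simple estimates" for the connecting horizontal segments, as at tex L1746).

This file (no new definitions, no facts): `norm_integrand65_horiz_le` — on `w = u ± i𝓛²⁰`, `−1 < u ≤ 0`,
the repaired (6.5) integrand is `≤ K_h := (64π²p²(10𝓛⁵¹⁹)² + e¹⁶e^{𝓛⁹}𝓛⁵¹⁹)(T³+1)e^{(1−𝓛⁴⁰)/4𝓛³⁰}`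
(`|Z(s+w)|` by `norm_Zfac_le_poly`, `|Z(s)(Pt₀)^{−w}| ≤ e¹⁶Pt₀`, `|Σ_{n<T³}…| ≤ T³ + 1`, `|P₄^w| ≤ 1`,
`|ω₁(u±i𝓛²⁰)| = e^{(u²−𝓛⁴⁰)/4𝓛³⁰}`, `|w| ≥ 𝓛²⁰`), and the numerical fact `horiz_le_exp`:
`K_h ≤ e^{−𝓛¹⁰/8}` once `𝓛 ≥ 60` (`p < 2P = 2e^{𝓛⁹}`, `T = e^{𝓛^{1.1}}`). Also `one_le_P4` (`P₄ ≥ 1`).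

## References

* Y. Zhang, arXiv:2211.02515v1 (2022), §6 p. 32, (6.3)–(6.5) and the last paragraph of the proof
  of Lemma 6.1; §5 Lemma 5.1; §4 (4.1) (`ω₁`). [cite: Zhang2022LandauSiegel, §6 (6.5)]
* H. L. Montgomery, R. C. Vaughan, *Multiplicative Number Theory I*, CUP 2007, Thm C.1 (Stirling),
  consumed through the tree's `GammaStirlingOrder` / `Section5VerticalShift`. [cite: montgomery2007, Thm C.1]
-/

noncomputable section

open Complex Real Set MeasureTheory intervalIntegral

namespace Literature.NumberTheory.LFunctions.Zhang2022.Section6Statements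

open Skeleton

variable {D : ℕ} (x : Chr D)

/-! ## Numeric bookkeeping for the horizontal sides of the rectangle -/

omit x in
/-- `L^n ≤ e^{nL}` for `L ≥ 0`. [folklore] -/
private theorem pow_le_exp_mul {L : ℝ} (hL : 0 ≤ L) (n : ℕ) : L ^ n ≤ Real.exp (n * L) := by
  rw [Real.exp_nat_mul]
  exact pow_le_pow_left₀ hL (by linarith [Real.add_one_le_exp L]) n

omit x in
/-- `256000 ≤ e¹³`. [folklore] -/
private theorem const_le_exp13 : (256000 : ℝ) ≤ Real.exp 13 := by
  have h1 : (2.7182818283 : ℝ) ^ 13 ≤ Real.exp 1 ^ 13 :=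
    pow_le_pow_left₀ (by norm_num) Real.exp_one_gt_d9.le 13
  have h2 : Real.exp 1 ^ 13 = Real.exp 13 := by rw [← Real.exp_nat_mul]; norm_num
  have h3 : (256000 : ℝ) ≤ (2.7182818283 : ℝ) ^ 13 := by norm_num
  linarith

omit x in
/-- The horizontal sides are `≤ e^{−𝓛¹⁰/8}`: the prefactor (Stirling size of `Z`, `|Z(s)|(Pt₀)`, the
`T³` terms of the head sum) is `≤ exp(O(𝓛⁹))` while `|ω₁(u ± i𝓛²⁰)| ≤ exp((1 − 𝓛⁴⁰)/4𝓛³⁰)`; for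
`𝓛 ≥ 60`. [cite: Zhang2022LandauSiegel, §6 p.32, tex L1777] -/
theorem horiz_le_exp {L p : ℝ} (hL : 60 ≤ L) (hp0 : 0 ≤ p) (hp : p ≤ 2 * Real.exp (L ^ 9)) :
    (64 * π ^ 2 * p ^ 2 * (10 * L ^ 519) ^ 2 + Real.exp 16 * (Real.exp (L ^ 9) * L ^ 519)) *
        (Real.exp (L ^ (1.1 : ℝ)) ^ 3 + 1) * Real.exp ((1 - (L ^ 20) ^ 2) / (4 * L ^ 30))
      ≤ Real.exp (-(1 / 8) * L ^ 10) := by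
  have hL0 : 0 < L := by linarith
  have hL1 : 1 ≤ L := by linarith
  obtain ⟨X, hX⟩ : ∃ X : ℝ, X = 2 * L ^ 9 + 1038 * L := ⟨_, rfl⟩
  -- factor A
  have hA : 64 * π ^ 2 * p ^ 2 * (10 * L ^ 519) ^ 2 + Real.exp 16 * (Real.exp (L ^ 9) * L ^ 519)
      ≤ Real.exp (17 + X) := by
    have e2 : Real.exp (2 * L ^ 9) = Real.exp (L ^ 9) ^ 2 := by
      rw [← Real.exp_nat_mul]; norm_num
    have h1 : p ^ 2 ≤ 4 * Real.exp (2 * L ^ 9) := by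
      rw [e2]; nlinarith [Real.exp_pos (L ^ 9)]
    have h1038 : L ^ 1038 ≤ Real.exp (1038 * L) := by
      have := pow_le_exp_mul hL0.le 1038; push_cast at this; exact this
    have h519 : L ^ 519 ≤ Real.exp (1038 * L) := by
      have := pow_le_exp_mul hL0.le 519
      push_cast at this
      exact this.trans (Real.exp_le_exp.mpr (by nlinarith))
    have h2 : (10 * L ^ 519) ^ 2 ≤ 100 * Real.exp (1038 * L) := by
      have e : (10 * L ^ 519) ^ 2 = 100 * L ^ 1038 := by ring
      rw [e]; linarith
    have hπ : (64 : ℝ) * π ^ 2 * 4 * 100 ≤ Real.exp 13 := by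
      nlinarith [Real.pi_lt_d2, Real.pi_pos, const_le_exp13]
    have t1 : 64 * π ^ 2 * p ^ 2 * (10 * L ^ 519) ^ 2 ≤ Real.exp 13 * Real.exp X := by
      have hX' : Real.exp X = Real.exp (2 * L ^ 9) * Real.exp (1038 * L) := by
        rw [hX, Real.exp_add]
      rw [hX']
      have hp2 : 0 ≤ p ^ 2 := sq_nonneg p
      calc 64 * π ^ 2 * p ^ 2 * (10 * L ^ 519) ^ 2
          ≤ 64 * π ^ 2 * (4 * Real.exp (2 * L ^ 9)) * (100 * Real.exp (1038 * L)) := by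
            gcongr
        _ = (64 * π ^ 2 * 4 * 100) * (Real.exp (2 * L ^ 9) * Real.exp (1038 * L)) := by ring
        _ ≤ Real.exp 13 * (Real.exp (2 * L ^ 9) * Real.exp (1038 * L)) := by
            gcongr
    have t2 : Real.exp 16 * (Real.exp (L ^ 9) * L ^ 519) ≤ Real.exp 16 * Real.exp X := by
      have hX' : Real.exp (L ^ 9) * Real.exp (1038 * L) ≤ Real.exp X := by
        rw [← Real.exp_add]; exact Real.exp_le_exp.mpr (by rw [hX]; nlinarith [pow_pos hL0 9])
      calc Real.exp 16 * (Real.exp (L ^ 9) * L ^ 519)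
          ≤ Real.exp 16 * (Real.exp (L ^ 9) * Real.exp (1038 * L)) := by gcongr
        _ ≤ Real.exp 16 * Real.exp X := by gcongr
    have h13 : Real.exp 13 ≤ Real.exp 16 := Real.exp_le_exp.mpr (by norm_num)
    have hsum : Real.exp 13 * Real.exp X + Real.exp 16 * Real.exp X ≤ Real.exp (17 + X) := by
      have h17 : (2 : ℝ) * Real.exp 16 ≤ Real.exp 17 := by
        have h := Real.add_one_le_exp (1 : ℝ)
        have : Real.exp 17 = Real.exp 1 * Real.exp 16 := by rw [← Real.exp_add]; norm_num
        rw [this]; nlinarith [Real.exp_pos (16 : ℝ)]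
      have hX0 : 0 < Real.exp X := Real.exp_pos X
      calc Real.exp 13 * Real.exp X + Real.exp 16 * Real.exp X
          ≤ Real.exp 16 * Real.exp X + Real.exp 16 * Real.exp X := by gcongr
        _ = 2 * Real.exp 16 * Real.exp X := by ring
        _ ≤ Real.exp 17 * Real.exp X := by gcongr
        _ = Real.exp (17 + X) := by rw [Real.exp_add]
    linarith
  -- factor B
  have hB : Real.exp (L ^ (1.1 : ℝ)) ^ 3 + 1 ≤ Real.exp (1 + 3 * L ^ 2) := by
    have h11 : L ^ (1.1 : ℝ) ≤ L ^ 2 := by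
      have := Real.rpow_le_rpow_of_exponent_le hL1 (by norm_num : (1.1 : ℝ) ≤ 2)
      rwa [Real.rpow_two] at this
    have h3 : Real.exp (L ^ (1.1 : ℝ)) ^ 3 ≤ Real.exp (3 * L ^ 2) := by
      rw [← Real.exp_nat_mul]; push_cast
      exact Real.exp_le_exp.mpr (by linarith)
    rw [Real.exp_add]
    have h := Real.add_one_le_exp (1 : ℝ)
    have hE1 : 1 ≤ Real.exp (3 * L ^ 2) := Real.one_le_exp (by positivity)
    have hm : (1 + 1) * Real.exp (3 * L ^ 2) ≤ Real.exp 1 * Real.exp (3 * L ^ 2) :=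
      mul_le_mul_of_nonneg_right h (Real.exp_pos _).le
    linarith
  -- factor C
  have hC : Real.exp ((1 - (L ^ 20) ^ 2) / (4 * L ^ 30)) ≤ Real.exp (1 - L ^ 10 / 4) := by
    refine Real.exp_le_exp.mpr ?_
    rw [div_le_iff₀ (by positivity)]
    have h40 : (L ^ 20) ^ 2 = L ^ 10 * L ^ 30 := by rw [← pow_mul, ← pow_add]
    have h30 : (1 : ℝ) ≤ L ^ 30 := one_le_pow₀ hL1
    rw [h40]; nlinarith
  -- the exponent
  have hexp : 17 + X + (1 + 3 * L ^ 2) + (1 - L ^ 10 / 4) ≤ -(1 / 8) * L ^ 10 := by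
    have h10 : L ^ 10 = L * L ^ 9 := by ring
    have h93 : L ^ 3 ≤ L ^ 9 := pow_le_pow_right₀ hL1 (by norm_num)
    have h3 : L ^ 3 = L * (L * L) := by ring
    have hsmall : 19 + 1038 * L + 3 * L ^ 2 ≤ L ^ 3 := by rw [h3]; nlinarith
    have h9 : 0 < L ^ 9 := by positivity
    rw [hX]; nlinarith
  have hpos : 0 ≤ Real.exp (L ^ (1.1 : ℝ)) ^ 3 + 1 := by positivity
  calc (64 * π ^ 2 * p ^ 2 * (10 * L ^ 519) ^ 2 + Real.exp 16 * (Real.exp (L ^ 9) * L ^ 519)) *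
        (Real.exp (L ^ (1.1 : ℝ)) ^ 3 + 1) * Real.exp ((1 - (L ^ 20) ^ 2) / (4 * L ^ 30))
      ≤ Real.exp (17 + X) * Real.exp (1 + 3 * L ^ 2) * Real.exp (1 - L ^ 10 / 4) := by
        gcongr
    _ = Real.exp (17 + X + (1 + 3 * L ^ 2) + (1 - L ^ 10 / 4)) := by
        rw [← Real.exp_add, ← Real.exp_add]
    _ ≤ Real.exp (-(1 / 8) * L ^ 10) := Real.exp_le_exp.mpr hexp

omit x in
/-- `𝓛 ≥ 60` once `D ≥ ⌈e⁶⁰⌉`. [cite: Zhang2022LandauSiegel, §2 (2.1)] -/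
theorem sixty_le_ell_of_le {D : ℕ} (hD : ⌈Real.exp 60⌉₊ ≤ D) : 60 ≤ ell D := by
  have h : Real.exp 60 ≤ D := le_trans (Nat.le_ceil _) (by exact_mod_cast hD)
  exact (Real.le_log_iff_exp_le (lt_of_lt_of_le (Real.exp_pos _) h)).mpr h


omit x in
/-- `P₄ ≥ 1` for `𝓛 ≥ 3` (`P₄ = e^{𝓛⁹}e^{−2𝓛^{1.1}}𝓛⁵¹⁹`). [cite: Zhang2022LandauSiegel, §6 p.30] -/
theorem one_le_P4 (hL : 3 ≤ ell D) : 1 ≤ P4 D := by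
  have hL1 : 1 ≤ ell D := by linarith
  have hL0 : 0 < ell D := by linarith
  have h11 : ell D ^ (1.1 : ℝ) ≤ ell D ^ 2 := by
    have := Real.rpow_le_rpow_of_exponent_le hL1 (by norm_num : (1.1 : ℝ) ≤ 2)
    rwa [Real.rpow_two] at this
  have h29 : ell D ^ 2 ≤ ell D ^ 9 := pow_le_pow_right₀ hL1 (by norm_num)
  have h22 : 2 * ell D ^ 2 ≤ ell D ^ 9 := by
    have h39 : ell D ^ 3 ≤ ell D ^ 9 := pow_le_pow_right₀ hL1 (by norm_num)
    have : ell D ^ 3 = ell D * ell D ^ 2 := by ring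
    nlinarith [pow_pos hL0 2]
  have hexp : bigT D ^ 2 ≤ bigP D := by
    rw [bigT, bigP, ← Real.exp_nat_mul]
    exact Real.exp_le_exp.mpr (by push_cast; linarith)
  have h519 : (1 : ℝ) ≤ t0 D := by rw [t0]; exact one_le_pow₀ hL1
  have hT2 : 0 < bigT D ^ 2 := pow_pos (Real.exp_pos _) 2
  rw [P4]
  exact one_le_mul_of_one_le_of_one_le ((one_le_div hT2).mpr hexp) h519

/-- **The horizontal sides, pointwise.** For `ψ ∈ Ψ`, `s = σ + it` with `|σ − 1/2| ≤ 1/4`,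
`5𝓛⁵¹⁹ ≤ t ≤ 8𝓛⁵¹⁹`, `|Z(s,ψ)| ≤ e¹⁶`, and `w = u ± i𝓛²⁰` with `−1 < u ≤ 0`: the (repaired) (6.5)
integrand satisfies `|(Z(s+w) − Z(s)(Pt₀)^{−w})(Σ_{n<T³} ψ̄(n)n^{−(1−s−w)})P₄^w ω₁(w)/w| ≤ K_h` with
`K_h = (64π²p²(10𝓛⁵¹⁹)² + e¹⁶·e^{𝓛⁹}𝓛⁵¹⁹)(T³ + 1)exp((1 − 𝓛⁴⁰)/4𝓛³⁰)` ("a trivial bound for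
`ω₁(w)` and simple estimates"). [cite: Zhang2022LandauSiegel, §6 p.32, tex L1746, L1777] -/
theorem norm_integrand65_horiz_le (hL : 3 ≤ ell D) {σ t u Vs : ℝ} (hσa : 1 / 4 ≤ σ) (hσb : σ ≤ 3 / 4)
    (ht5 : 5 * ell D ^ 519 ≤ t) (ht8 : t ≤ 8 * ell D ^ 519) (hu1 : -1 < u) (hu0 : u ≤ 0)
    (hVs : |Vs| = ell D ^ 20)
    (hZs : ‖GammaFactor.Zfac x.ψ ((σ : ℂ) + t * I)‖ ≤ Real.exp 16) :
    ‖(GammaFactor.Zfac x.ψ (((σ : ℂ) + t * I) + ((u : ℂ) + (Vs : ℂ) * I)) -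
          GammaFactor.Zfac x.ψ ((σ : ℂ) + t * I) *
            ((bigP D * t0 D : ℝ) : ℂ) ^ (-((u : ℂ) + (Vs : ℂ) * I))) *
        headSum x (bigT D ^ 3) ((σ : ℂ) + t * I) ((u : ℂ) + (Vs : ℂ) * I) *
        kern D ((u : ℂ) + (Vs : ℂ) * I)‖
      ≤ (64 * π ^ 2 * (x.p : ℝ) ^ 2 * (10 * ell D ^ 519) ^ 2 +
            Real.exp 16 * (Real.exp (ell D ^ 9) * ell D ^ 519)) *
          (Real.exp (ell D ^ (1.1 : ℝ)) ^ 3 + 1) *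
          Real.exp ((1 - (ell D ^ 20) ^ 2) / (4 * ell D ^ 30)) := by
  have hL1 : 1 ≤ ell D := by linarith
  have hL0 : 0 < ell D := by linarith
  have hD2 : 1 ≤ ell D ^ 519 := one_le_pow₀ hL1
  have hV1 : (1 : ℝ) ≤ ell D ^ 20 := one_le_pow₀ hL1
  have hV519 : ell D ^ 20 ≤ ell D ^ 519 := pow_le_pow_right₀ hL1 (by norm_num)
  have hP0 : 0 < bigP D := Real.exp_pos _
  have hP1 : 1 ≤ bigP D := by rw [bigP]; exact Real.one_le_exp (by positivity)
  have ht00 : 1 ≤ t0 D := by rw [t0]; exact hD2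
  have hR0 : 0 < bigP D * t0 D := mul_pos hP0 (lt_of_lt_of_le one_pos ht00)
  have hR1 : 1 ≤ bigP D * t0 D := one_le_mul_of_one_le_of_one_le hP1 ht00
  have hP4 : 0 < P4 D := lt_of_lt_of_le one_pos (one_le_P4 hL)
  set sC : ℂ := (σ : ℂ) + t * I with hsC
  set w : ℂ := (u : ℂ) + (Vs : ℂ) * I with hw
  have hwre : w.re = u := by simp [hw]
  have hwim : w.im = Vs := by simp [hw]
  -- `|Z(s+w)|`
  have hsw : sC + w = ((σ + u : ℝ) : ℂ) + ((t + Vs : ℝ) : ℂ) * I := by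
    simp only [hsC, hw]; push_cast; ring
  have hVle : -ell D ^ 20 ≤ Vs ∧ Vs ≤ ell D ^ 20 := abs_le.mp hVs.le
  have htV : 1 ≤ t + Vs := by linarith [hVle.1]
  have htV' : 1 + (t + Vs) ≤ 10 * ell D ^ 519 := by linarith [hVle.2]
  have hZw : ‖GammaFactor.Zfac x.ψ (sC + w)‖ ≤
      64 * π ^ 2 * (x.p : ℝ) ^ 2 * (10 * ell D ^ 519) ^ 2 := by
    rw [hsw]
    refine (norm_Zfac_le_poly x.prim (by linarith) (by linarith) htV).trans ?_
    have h32 : (1 + (t + Vs)) ^ ((3 : ℝ) / 2) ≤ (10 * ell D ^ 519) ^ 2 := by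
      calc (1 + (t + Vs)) ^ ((3 : ℝ) / 2) ≤ (1 + (t + Vs)) ^ (2 : ℝ) :=
            Real.rpow_le_rpow_of_exponent_le (by linarith) (by norm_num)
        _ = (1 + (t + Vs)) ^ 2 := Real.rpow_two _
        _ ≤ (10 * ell D ^ 519) ^ 2 := pow_le_pow_left₀ (by linarith) htV' 2
    exact mul_le_mul_of_nonneg_left h32 (by positivity)
  -- `|Z(s)(Pt₀)^{−w}|`
  have hZR : ‖GammaFactor.Zfac x.ψ sC * ((bigP D * t0 D : ℝ) : ℂ) ^ (-w)‖ ≤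
      Real.exp 16 * (Real.exp (ell D ^ 9) * ell D ^ 519) := by
    rw [norm_mul, Complex.norm_cpow_eq_rpow_re_of_pos hR0]
    have h1 : (bigP D * t0 D) ^ ((-w).re) ≤ bigP D * t0 D := by
      refine Real.rpow_le_self_of_one_le hR1 ?_
      rw [Complex.neg_re, hwre]; linarith
    have h2 : bigP D * t0 D = Real.exp (ell D ^ 9) * ell D ^ 519 := by rw [bigP, t0]
    calc ‖GammaFactor.Zfac x.ψ sC‖ * (bigP D * t0 D) ^ ((-w).re)
        ≤ Real.exp 16 * (bigP D * t0 D) :=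
          mul_le_mul hZs h1 (Real.rpow_nonneg hR0.le _) (Real.exp_pos _).le
      _ = Real.exp 16 * (Real.exp (ell D ^ 9) * ell D ^ 519) := by rw [h2]
  have hNw : ‖GammaFactor.Zfac x.ψ (sC + w) -
        GammaFactor.Zfac x.ψ sC * ((bigP D * t0 D : ℝ) : ℂ) ^ (-w)‖ ≤
      64 * π ^ 2 * (x.p : ℝ) ^ 2 * (10 * ell D ^ 519) ^ 2 +
        Real.exp 16 * (Real.exp (ell D ^ 9) * ell D ^ 519) :=
    (norm_sub_le _ _).trans (add_le_add hZw hZR)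
  -- `|H(w)| ≤ T³ + 1`
  have hHw : ‖headSum x (bigT D ^ 3) sC w‖ ≤ Real.exp (ell D ^ (1.1 : ℝ)) ^ 3 + 1 := by
    simp only [headSum]
    have hterm : ∀ n ∈ Finset.Ico 1 ⌈bigT D ^ 3⌉₊,
        ‖psiBarFn x n * (n : ℂ) ^ (-(1 - sC - w))‖ ≤ 1 := by
      intro n hn
      have hn1 : 1 ≤ n := (Finset.mem_Ico.mp hn).1
      rw [norm_mul]
      have h1 : ‖psiBarFn x n‖ ≤ 1 := by
        simp only [psiBarFn, Complex.norm_conj]; exact DirichletCharacter.norm_le_one _ _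
      have h2 : ‖(n : ℂ) ^ (-(1 - sC - w))‖ ≤ 1 := by
        rw [Complex.norm_natCast_cpow_of_pos (by omega)]
        refine Real.rpow_le_one_of_one_le_of_nonpos (by exact_mod_cast hn1) ?_
        have : (-(1 - sC - w)).re = -(1 - σ - u) := by simp [hsC, hwre]
        rw [this]; linarith
      calc ‖psiBarFn x n‖ * ‖(n : ℂ) ^ (-(1 - sC - w))‖ ≤ 1 * 1 :=
            mul_le_mul h1 h2 (norm_nonneg _) zero_le_one
        _ = 1 := one_mul _
    calc ‖∑ n ∈ Finset.Ico 1 ⌈bigT D ^ 3⌉₊, psiBarFn x n * (n : ℂ) ^ (-(1 - sC - w))‖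
        ≤ ∑ n ∈ Finset.Ico 1 ⌈bigT D ^ 3⌉₊, ‖psiBarFn x n * (n : ℂ) ^ (-(1 - sC - w))‖ :=
          norm_sum_le _ _
      _ ≤ ∑ n ∈ Finset.Ico 1 ⌈bigT D ^ 3⌉₊, (1 : ℝ) := Finset.sum_le_sum hterm
      _ = ((⌈bigT D ^ 3⌉₊ - 1 : ℕ) : ℝ) := by simp
      _ ≤ (⌈bigT D ^ 3⌉₊ : ℝ) := by exact_mod_cast Nat.sub_le _ _
      _ ≤ bigT D ^ 3 + 1 := (Nat.ceil_lt_add_one (pow_nonneg (le_of_lt (Real.exp_pos _)) 3)).le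
      _ = Real.exp (ell D ^ (1.1 : ℝ)) ^ 3 + 1 := by rw [bigT]
  -- `|kern(w)| ≤ |ω₁(w)| ≤ exp((1 − 𝓛⁴⁰)/4𝓛³⁰)`
  have hKw : ‖kern D w‖ ≤ Real.exp ((1 - (ell D ^ 20) ^ 2) / (4 * ell D ^ 30)) := by
    simp only [kern]
    rw [norm_div, norm_mul, Complex.norm_cpow_eq_rpow_re_of_pos hP4, hwre]
    have h1 : P4 D ^ u ≤ 1 := Real.rpow_le_one_of_one_le_of_nonpos (one_le_P4 hL) hu0
    have h2 : ‖GaussWeight.omega1 (ell D ^ 30) w‖ ≤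
        Real.exp ((1 - (ell D ^ 20) ^ 2) / (4 * ell D ^ 30)) := by
      rw [hw, GaussWeight.norm_omega1]
      refine Real.exp_le_exp.mpr (div_le_div_of_nonneg_right ?_ (by positivity))
      have hu2 : u ^ 2 ≤ 1 := by
        have : |u| ≤ 1 := abs_le.mpr ⟨by linarith, by linarith⟩
        exact (sq_le_one_iff_abs_le_one u).mpr this
      have hVs2 : Vs ^ 2 = (ell D ^ 20) ^ 2 := by rw [← sq_abs, hVs]
      linarith
    have h3 : 1 ≤ ‖w‖ := by
      have := Complex.abs_im_le_norm w
      rw [hwim, hVs] at this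
      exact hV1.trans this
    have h4 : 0 ≤ ‖GaussWeight.omega1 (ell D ^ 30) w‖ := norm_nonneg _
    have h5 : 0 ≤ P4 D ^ u := Real.rpow_nonneg hP4.le _
    calc P4 D ^ u * ‖GaussWeight.omega1 (ell D ^ 30) w‖ / ‖w‖
        ≤ P4 D ^ u * ‖GaussWeight.omega1 (ell D ^ 30) w‖ :=
          div_le_self (mul_nonneg h5 h4) h3
      _ ≤ 1 * Real.exp ((1 - (ell D ^ 20) ^ 2) / (4 * ell D ^ 30)) :=
          mul_le_mul h1 h2 h4 zero_le_one
      _ = _ := one_mul _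
  have hA0 : 0 ≤ 64 * π ^ 2 * (x.p : ℝ) ^ 2 * (10 * ell D ^ 519) ^ 2 +
      Real.exp 16 * (Real.exp (ell D ^ 9) * ell D ^ 519) := by positivity
  have hB0 : 0 ≤ Real.exp (ell D ^ (1.1 : ℝ)) ^ 3 + 1 := by positivity
  rw [norm_mul, norm_mul]
  exact mul_le_mul (mul_le_mul hNw hHw (norm_nonneg _) hA0) hKw (norm_nonneg _)
    (mul_nonneg hA0 hB0)
end Literature.NumberTheory.LFunctions.Zhang2022.Section6Statements
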